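import Summits.SmoothPoincare4.SmoothPoincare4.Theorems.EntropyRungMargerinRailsDefs
import Literature.Geometry.Riemannian.ChangGurskyYangWeylBudget
import Literature.Geometry.Riemannian.PinchingCurvatureBound
import Literature.Geometry.Riemannian.ChangGurskyYangRegularity
import HarnessLib

/-!
# Route EntropyRung · crux `ChangGurskyYang` · line `margerin-cone-hamilton-rails` — STUB 2 `stub_initialFit`
# (the dictionary weak pinching ↔ Hamilton blocks, and the compactness fit into one pinching set)

Stub `stub_initialFit` of the registered skeleton
`Cruxes/ChangGurskyYang/Lines/margerin-cone-hamilton-rails.lean` of crux stmt-SmoothPoincare4-10834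
(`Summit.SmoothPoincare4.SmoothPoincare4.Theses.EntropyRung.ChangGurskyYang`), over the vocabulary of
`Theorems/EntropyRungMargerinRailsDefs.lean` (`frobSq`, `scal`, `rmNormSq`, `devNormSq`,
`margerinCone`, `pinchingSet`).

Mathematics (Margerin 1998, Part I, p. 25; Chang–Gursky–Yang 2003, (0.2); Hamilton 1986, §7,
Thm. 7.1, p. 170: "every compact subset … lies in some such pinching set"):

* DICTIONARY. For the blocks `(A, B, C)` of a Levi-Civita connection of a `C²` metric in a frame
  `e` one has the `(0,4)`-Pythagoras `Σ_{ijkl} Rm(eᵢ,eⱼ,e_k,e_l)² = ‖A‖² + 2‖B‖² + ‖C‖²`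
  (`sum_sq_eq_blockArr`: a polynomial identity in the `21` independent curvature components
  modulo antisymmetry and pair symmetry — the blocks are the matrix of `Rm` on Hamilton's bivectors
  `φᵢ`, `ψᵢ` of norm `√2`; `rmNormSq_blocks_eq_curvNormSqFrame`), `tr A + tr C = R(x)` in an
  orthonormal frame (`trace_blockA_add_trace_blockC`), hence with `|Rm|² = |W|² + 2|E|² + R²/6`
  (`curvNormSqFrame_eq`) Margerin's deviation is `|𝒟|² = |W|² + 2|E|² = WP(x)·R(x)²`
  (`devNormSq_blocks_eq`, `weakPinching_eq_of_isOrthonormalFrame`); all Levi-Civita connections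
  of `g` have the same curvature form (`IsLeviCivita.curvature_eq_riemann`), so the same blocks
  (`blocks_eq_leviCivita_of_isLeviCivita`); `A`, `C` are symmetric with `tr A = tr C` (`blockA_isSymm`,
  `blockC_isSymm`, `trace_blockA_eq_trace_blockC`).
* COMPACTNESS. On a closed manifold `R` and `WP = (|W|² + 2|E|²)/R²` are continuous
  (`contMDiff_scalarCurvature`, `continuous_weylNormSq`, `continuous_tracelessRicciNormSq`), so
  `m := min R > 0`, `R ≤ R_max`, `WP ≤ max WP < 1/6`; with `c := max (max WP) (1/12)` and, for
  `τ ∈ [0, 1]`, `K := c·R_max²/m^{2−τ} + 1`: `|𝒟|² = WP·R² ≤ c R²`, and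
  `|𝒟|² ≤ c R_max² ≤ K m^{2−τ} ≤ K R^{2−τ}` (`Real.rpow_le_rpow`). The empty manifold is vacuous.

References: C. Margerin, Comm. Anal. Geom. 6 (1998) 21–65, Part I, p. 25 [Margerin1998];
S.-Y. A. Chang, M. J. Gursky, P. C. Yang, Publ. Math. IHÉS 98 (2003), (0.2) and Remark 2
[ChangGurskyYang2003]; R. S. Hamilton, J. Differential Geom. 24 (1986), §6 (blocks), §7 Thm. 7.1
[Hamilton1986]; R. S. Hamilton, Comm. Anal. Geom. 5 (1997), §1.2 (bases `φᵢ`, `ψᵢ`) [Hamilton1997];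
A. L. Besse, Einstein Manifolds (1987), 1.114 [Besse1987].
-/

noncomputable section

-- every `Summit.SmoothPoincare4.SmoothPoincare4.…` name repeats the summit = sub-problem segment (D-0017 layout)
set_option linter.dupNamespace false

open Set Function Module
open scoped Manifold ContDiff Matrix BigOperators Topology

namespace Summit.SmoothPoincare4.SmoothPoincare4.Theorems.MargerinRails

open Literature.Geometry.Riemannian Literature.Geometry.Riemannian.HamiltonODE
open Literature.Geometry.Lorentzian Literature.Geometry.Lorentzian.PseudoRiemannianMetric

/-! ## The `(0,4)`-Pythagoras `Σ Rm² = ‖A‖² + 2‖B‖² + ‖C‖²` on curvature arrays -/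

/-- **`Σ_{ijkl} R_{ijkl}² = ‖A‖_F² + 2‖B‖_F² + ‖C‖_F²`** for an array `R` on `Fin 4` antisymmetric in
each pair and pair-symmetric, where `A`, `B`, `C` are Hamilton's block arrays
(`WeylBlocks.blockArr` on the index tables `sdIdx`, `asdIdx`: `A_{ij} = R(φᵢ, φⱼ)`, `B_{ij} = R(φᵢ, ψⱼ)`,
`C_{ij} = R(ψᵢ, ψⱼ)` with `R(X∧Y, Z∧W) = R_{XYWZ}`): the `(0,4)`-norm is `4×` the Hilbert–Schmidt norm
on `Λ²`, and `φᵢ/√2`, `ψᵢ/√2` is an orthonormal basis of `Λ²` (Chang–Gursky–Yang 2003, Remark 2;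
Hamilton 1986, §6). A polynomial identity in the `21` independent components (no Bianchi identity
needed), verified by normalising the `256`-term sum with `ring`, as
`WeylBlocks.sum_weylArr_sq_eq_blocksNormSq`. [cite: ChangGurskyYang2003, (0.2) and Remark 2] -/
theorem sum_sq_eq_blockArr (R : Fin 4 → Fin 4 → Fin 4 → Fin 4 → ℝ)
    (h12 : ∀ a b c d, R a b c d = -R b a c d) (h34 : ∀ a b c d, R a b c d = -R a b d c)
    (hp : ∀ a b c d, R a b c d = R c d a b) :
    ∑ i, ∑ j, ∑ k, ∑ l, R i j k l ^ 2 =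
      (∑ i, ∑ j, WeylBlocks.blockArr WeylBlocks.sdIdx WeylBlocks.sdIdx R i j ^ 2) +
        2 * (∑ i, ∑ j, WeylBlocks.blockArr WeylBlocks.sdIdx WeylBlocks.asdIdx R i j ^ 2) +
        ∑ i, ∑ j, WeylBlocks.blockArr WeylBlocks.asdIdx WeylBlocks.asdIdx R i j ^ 2 := by
  have hz12 : ∀ a c d, R a a c d = 0 := fun a c d ↦ by have := h12 a a c d; linarith
  have hz34 : ∀ a b c, R a b c c = 0 := fun a b c ↦ by have := h34 a b c c; linarith
  simp only [WeylBlocks.blockArr, Fin.sum_univ_four, Fin.sum_univ_three, Fin.sum_univ_two,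
    Fin.isValue, WeylBlocks.sdIdx_0_0, WeylBlocks.sdIdx_0_1, WeylBlocks.sdIdx_1_0,
    WeylBlocks.sdIdx_1_1, WeylBlocks.sdIdx_2_0, WeylBlocks.sdIdx_2_1, WeylBlocks.asdIdx_0_0,
    WeylBlocks.asdIdx_0_1, WeylBlocks.asdIdx_1_0, WeylBlocks.asdIdx_1_1, WeylBlocks.asdIdx_2_0,
    WeylBlocks.asdIdx_2_1]
  simp only [hz12, hz34, h12 1 0, h12 2 0, h12 2 1, h12 3 0, h12 3 1, h12 3 2,
    fun a b => h34 a b 1 0, fun a b => h34 a b 2 0, fun a b => h34 a b 2 1,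
    fun a b => h34 a b 3 0, fun a b => h34 a b 3 1, fun a b => h34 a b 3 2, hp 0 2 0 1,
    hp 0 3 0 1, hp 0 3 0 2, hp 1 2 0 1, hp 1 2 0 2, hp 1 2 0 3, hp 1 3 0 1, hp 1 3 0 2,
    hp 1 3 0 3, hp 1 3 1 2, hp 2 3 0 1, hp 2 3 0 2, hp 2 3 0 3, hp 2 3 1 2, hp 2 3 1 3]
  ring

/-! ## The dictionary for a metric: blocks of Levi-Civita connections -/

section Dictionary

variable {E : Type*} [NormedAddCommGroup E] [NormedSpace ℝ E] {H : Type*} [TopologicalSpace H]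
  {I : ModelWithCorners ℝ E H} {M : Type*} [TopologicalSpace M] [ChartedSpace H M]
  [IsManifold I ∞ M] {n : ℕ∞ω}
  (g : PseudoRiemannianMetric I n E (TangentSpace I : M → Type _))
  (cov : CovariantDerivative I E (TangentSpace I : M → Type _))

/-- `B_{ij}` is the array block `blockArr sdIdx asdIdx` of the frame components
`R_{abcd} = Rm(e_a, e_b, e_c, e_d)` (companion of `blockA_eq_blockArr`, `blockC_eq_blockArr`).
[cite: Hamilton1997, §1.2, pp. 4–5] -/
theorem blockB_eq_blockArr {x : M} (e : Fin 4 → TangentSpace I x) (i j : Fin 3) :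
    g.blockB cov x e i j =
      WeylBlocks.blockArr WeylBlocks.sdIdx WeylBlocks.asdIdx
        (fun a b c d ↦ g.curvatureForm cov x (e a) (e b) (e c) (e d)) i j := by
  simp only [blockB, Matrix.of_apply, pairingCurvature, bivectorCurvature, WeylBlocks.blockArr,
    selfDualPairs_eq_sdIdx, antiSelfDualPairs_eq_asdIdx]

variable [FiniteDimensional ℝ E] [CompleteSpace E] [Fact (1 ≤ n)]

variable {g cov} in
/-- **All Levi-Civita connections of a `C²` metric have the same Hamilton blocks** (their curvature
tensors coincide with `g.riemann`, `IsLeviCivita.curvature_eq_riemann`; O'Neill 1983, Thm. 3.11 with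
Lemma 3.35). [cite: ONeill1983, Ch. 3, Thm. 3.11 and Lemma 3.35] -/
theorem blocks_eq_leviCivita_of_isLeviCivita [g.HasLeviCivita] (h : g.IsLeviCivita cov) (hn : 2 ≤ n)
    (x : M) (e : Fin 4 → TangentSpace I x) :
    (g.blockA cov x e, g.blockB cov x e, g.blockC cov x e) =
      (g.blockA g.leviCivita x e, g.blockB g.leviCivita x e, g.blockC g.leviCivita x e) := by
  have hfun : g.curvatureForm cov x = g.curvatureForm g.leviCivita x := by
    funext X Y Z W
    simp only [curvatureForm, h.curvature_eq_riemann hn x]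
    rfl
  simp only [blockA, blockB, blockC, pairingCurvature, bivectorCurvature, hfun]

variable [g.HasLeviCivita]

/-- **`‖A‖² + 2‖B‖² + ‖C‖² = Σ_{ijkl} Rm(eᵢ,eⱼ,e_k,e_l)²`** for the blocks of the Levi-Civita
connection of a `C²` metric in ANY `4`-frame (`sum_sq_eq_blockArr` with the curvature symmetries of
O'Neill 1983, Prop. 3.36). [cite: ChangGurskyYang2003, (0.2) and Remark 2] -/
theorem rmNormSq_blocks_eq_curvNormSqFrame (hn : 2 ≤ n) (x : M) (e : Fin 4 → TangentSpace I x) :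
    rmNormSq (g.blockA g.leviCivita x e, g.blockB g.leviCivita x e, g.blockC g.leviCivita x e) =
      g.curvNormSqFrame x e := by
  have hLC : g.IsLeviCivita g.leviCivita := isLeviCivita_leviCivita_holds
  set R : Fin 4 → Fin 4 → Fin 4 → Fin 4 → ℝ :=
    fun a b c d ↦ g.curvatureForm g.leviCivita x (e a) (e b) (e c) (e d)
  have h12 : ∀ a b c d, R a b c d = -R b a c d :=
    fun a b c d ↦ g.curvatureForm_antisymm g.leviCivita x (e a) (e b) (e c) (e d)
  have h34 : ∀ a b c d, R a b c d = -R a b d c :=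
    fun a b c d ↦ g.curvatureForm_leviCivita_antisymm₃₄ hn x (e a) (e b) (e c) (e d)
  have hp : ∀ a b c d, R a b c d = R c d a b :=
    fun a b c d ↦ hLC.val_curvature_pair_symm hn x (e a) (e b) (e c) (e d)
  have key := sum_sq_eq_blockArr R h12 h34 hp
  have hA : ∀ i j, g.blockA g.leviCivita x e i j =
      WeylBlocks.blockArr WeylBlocks.sdIdx WeylBlocks.sdIdx R i j := blockA_eq_blockArr g g.leviCivita e
  have hB : ∀ i j, g.blockB g.leviCivita x e i j =
      WeylBlocks.blockArr WeylBlocks.sdIdx WeylBlocks.asdIdx R i j := blockB_eq_blockArr g g.leviCivita e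
  have hC : ∀ i j, g.blockC g.leviCivita x e i j =
      WeylBlocks.blockArr WeylBlocks.asdIdx WeylBlocks.asdIdx R i j := blockC_eq_blockArr g g.leviCivita e
  rw [curvNormSqFrame]
  change _ = ∑ i, ∑ j, ∑ k, ∑ l, R i j k l ^ 2
  rw [key]
  simp only [rmNormSq, frobSq, hA, hB, hC]

/-- **`tr A + tr C = R(x)` in an orthonormal `4`-frame** on a `4`-dimensional model, for the
Levi-Civita connection (`trace_blockA_add_trace_blockC`; Chen–Zhu 2006, p. 4: `tr A = tr C = ½R`).
[cite: ChenZhu2006, §2, p. 4] -/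
theorem scal_blocks_eq (hn : 2 ≤ n) (hE : finrank ℝ E = 4) {x : M} {e : Fin 4 → TangentSpace I x}
    (he : g.IsOrthonormalFrame x e) :
    scal (g.blockA g.leviCivita x e, g.blockB g.leviCivita x e, g.blockC g.leviCivita x e) =
      g.scalarCurvature x := by
  have hLC : g.IsLeviCivita g.leviCivita := isLeviCivita_leviCivita_holds
  have hι : Fintype.card (Fin 4) = finrank ℝ E := by rw [Fintype.card_fin, hE]
  have h := trace_blockA_add_trace_blockC x hLC hn (he.toBasis hι)
    (by rw [he.coe_toBasis hι]; exact he)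
  rw [he.coe_toBasis hι] at h
  rw [scal]
  exact h.trans (g.scalarCurvatureWith_leviCivita x)

/-- **Margerin's deviation of the blocks is `|W|² + 2|E|²`** in an orthonormal `4`-frame on a
`4`-dimensional model (`|𝒟|² = |Rm|² − R²/6`, `|Rm|² = |W|² + 2|E|² + R²/6`, Besse 1987, 1.114;
Chang–Gursky–Yang 2003, (0.2): `|Z|² = |W|² + 2|E|²`; Margerin 1998, p. 25).
[cite: ChangGurskyYang2003, (0.2)] [cite: Margerin1998, Part I, p. 25] -/
theorem devNormSq_blocks_eq (hn : 2 ≤ n) (hE : finrank ℝ E = 4) {x : M}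
    {e : Fin 4 → TangentSpace I x} (he : g.IsOrthonormalFrame x e) :
    devNormSq (g.blockA g.leviCivita x e, g.blockB g.leviCivita x e, g.blockC g.leviCivita x e) =
      g.weylNormSqFrame x e + 2 * g.tracelessRicciNormSqFrame x e := by
  rw [devNormSq, rmNormSq_blocks_eq_curvNormSqFrame g hn x e, scal_blocks_eq g hn hE he,
    g.curvNormSqFrame_eq hn hE he]
  ring

/-- **`|𝒟|²(blocks) = WP(x) · R(x)²`** in an orthonormal `4`-frame on a `4`-dimensional model, at a
point of nonzero scalar curvature (`weakPinching_eq_of_isOrthonormalFrame`).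
[cite: ChangGurskyYang2003, (0.2)] [cite: Margerin1998, Part I, p. 25] -/
theorem devNormSq_blocks_eq_weakPinching_mul (hn : 2 ≤ n) (hE : finrank ℝ E = 4) {x : M}
    {e : Fin 4 → TangentSpace I x} (he : g.IsOrthonormalFrame x e) (hS : g.scalarCurvature x ≠ 0) :
    devNormSq (g.blockA g.leviCivita x e, g.blockB g.leviCivita x e, g.blockC g.leviCivita x e) =
      g.weakPinching x * g.scalarCurvature x ^ 2 := by
  rw [devNormSq_blocks_eq g hn hE he, g.weakPinching_eq_of_isOrthonormalFrame hE he,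
    div_mul_cancel₀ _ (pow_ne_zero 2 hS)]

end Dictionary

/-! ## STUB 2 of the line: the initial fit -/

/-- **STUB 2 — INITIAL FIT (dictionary `WP`/blocks + compactness).** On a closed smooth
4-manifold with a `C^∞` Riemannian metric `g` of positive scalar curvature and weak pinching
`WP < 1/6` pointwise there are `m > 0`, `0 < c < 1/6` such that for every `τ ∈ [0, 1]` some `K > 0`
puts the Hamilton blocks `(A, B, C)` of EVERY Levi-Civita connection of `g`, at every point in every
`g`-orthonormal frame, into `pinchingSet m c K τ`: (i) the blocks of a Levi-Civita connection are
symmetric with `tr A = tr C` (`blockA_isSymm`, `blockC_isSymm`, `trace_blockA_eq_trace_blockC`),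
`tr A + tr C = R(x)` and `|𝒟|²(blocks) = |W|² + 2|E|² = WP(x)·R(x)²` in an orthonormal frame
(`devNormSq_blocks_eq_weakPinching_mul`), all Levi-Civita connections having the same blocks
(`blocks_eq_leviCivita_of_isLeviCivita`); (ii) `R ≥ m := min R > 0`, `R ≤ max R`, `WP ≤ max WP < 1/6` by
continuity on the compact `M`, `c := max (max WP) (1/12)`, `K := c·R_max²/m^{2−τ} + 1`; vacuous on
the empty manifold. [cite: Margerin1998, Part I, p. 25] [cite: ChangGurskyYang2003, (0.2)]
[cite: Hamilton1986, §7, Thm. 7.1 (p. 170)] -/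
theorem stub_initialFit :
    ∀ (M : Type) [TopologicalSpace M] [T2Space M] [SecondCountableTopology M]
      [ChartedSpace (EuclideanSpace ℝ (Fin 4)) M] [IsManifold (𝓡 4) ∞ M] [CompactSpace M]
      (g : PseudoRiemannianMetric (𝓡 4) ∞ (EuclideanSpace ℝ (Fin 4)) (TangentSpace (𝓡 4) : M → Type _))
      [g.HasLeviCivita], g.IsRiemannian → (∀ x, 0 < g.scalarCurvature x) →
      (∀ x, g.weakPinching x < 1 / 6) →
      ∃ m c : ℝ, 0 < m ∧ 0 < c ∧ c < 1 / 6 ∧ ∀ τ : ℝ, 0 ≤ τ → τ ≤ 1 → ∃ K : ℝ, 0 < K ∧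
        ∀ (cov : CovariantDerivative (𝓡 4) (EuclideanSpace ℝ (Fin 4)) (TangentSpace (𝓡 4) : M → Type _)),
          g.IsLeviCivita cov →
          ∀ (x : M) (e : Fin 4 → TangentSpace (𝓡 4) x), g.IsOrthonormalFrame x e →
            (g.blockA cov x e, g.blockB cov x e, g.blockC cov x e) ∈ pinchingSet m c K τ := by
  intro M _ _ _ _ _ _ g _ hg hR hWP
  have hn : (2 : ℕ∞ω) ≤ ∞ := WithTop.coe_le_coe.mpr le_top
  have hE : finrank ℝ (EuclideanSpace ℝ (Fin 4)) = 4 := finrank_euclideanSpace_fin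
  -- continuity of `R` and of `WP = (|W|² + 2|E|²)/R²` (`R ≠ 0` everywhere)
  have hRc : Continuous g.scalarCurvature := g.contMDiff_scalarCurvature.continuous
  have hWPc : Continuous g.weakPinching := by
    have hdef : g.weakPinching =
        fun x ↦ (g.weylNormSq x + 2 * g.tracelessRicciNormSq x) / g.scalarCurvature x ^ 2 := rfl
    rw [hdef]
    exact ((g.continuous_weylNormSq hg hE).add
      (continuous_const.mul (g.continuous_tracelessRicciNormSq hg hE))).div (hRc.pow 2)
      fun x ↦ pow_ne_zero 2 (hR x).ne'
  rcases isEmpty_or_nonempty M with hM | hM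
  · -- the empty manifold: everything is vacuous
    exact ⟨1, 1 / 12, one_pos, by norm_num, by norm_num, fun τ _ _ ↦
      ⟨1, one_pos, fun cov _ x ↦ (IsEmpty.false x).elim⟩⟩
  -- extrema of `R` and `WP` on the compact manifold
  obtain ⟨xm, -, hxm⟩ := isCompact_univ.exists_isMinOn univ_nonempty hRc.continuousOn
  obtain ⟨xM, -, hxM⟩ := isCompact_univ.exists_isMaxOn univ_nonempty hRc.continuousOn
  obtain ⟨xw, -, hxw⟩ := isCompact_univ.exists_isMaxOn univ_nonempty hWPc.continuousOn
  set m : ℝ := g.scalarCurvature xm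
  set RM : ℝ := g.scalarCurvature xM
  set c : ℝ := max (g.weakPinching xw) (1 / 12)
  have hm : 0 < m := hR xm
  have hc0 : 0 < c := lt_max_of_lt_right (by norm_num)
  have hc6 : c < 1 / 6 := max_lt (hWP xw) (by norm_num)
  refine ⟨m, c, hm, hc0, hc6, fun τ hτ0 hτ1 ↦ ?_⟩
  have hmτ : 0 < m ^ (2 - τ) := Real.rpow_pos_of_pos hm _
  have hK : 0 < c * RM ^ 2 / m ^ (2 - τ) + 1 := by positivity
  refine ⟨c * RM ^ 2 / m ^ (2 - τ) + 1, hK, fun cov hcov x e he ↦ ?_⟩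
  -- pointwise consequences of the extrema
  have hRx : m ≤ g.scalarCurvature x := hxm (mem_univ x)
  have hRxM : g.scalarCurvature x ≤ RM := hxM (mem_univ x)
  have hWx : g.weakPinching x ≤ c := (hxw (mem_univ x)).trans (le_max_left _ _)
  have hRpos : 0 < g.scalarCurvature x := hR x
  have hWnn : 0 ≤ g.weakPinching x := g.weakPinching_nonneg x
  -- dictionary: reduce to the canonical Levi-Civita connection
  rw [blocks_eq_leviCivita_of_isLeviCivita hcov hn x e]
  have hLC : g.IsLeviCivita g.leviCivita := isLeviCivita_leviCivita_holds
  have hscal := scal_blocks_eq g hn hE he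
  have hdev := devNormSq_blocks_eq_weakPinching_mul g hn hE he hRpos.ne'
  -- the two pinching inequalities
  have hcone : g.weakPinching x * g.scalarCurvature x ^ 2 ≤ c * g.scalarCurvature x ^ 2 :=
    mul_le_mul_of_nonneg_right hWx (sq_nonneg _)
  have hsq : g.scalarCurvature x ^ 2 ≤ RM ^ 2 := pow_le_pow_left₀ hRpos.le hRxM 2
  have hrpow : m ^ (2 - τ) ≤ g.scalarCurvature x ^ (2 - τ) :=
    Real.rpow_le_rpow hm.le hRx (by linarith)
  have hKm : (c * RM ^ 2 / m ^ (2 - τ) + 1) * m ^ (2 - τ) = c * RM ^ 2 + m ^ (2 - τ) := by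
    rw [add_mul, one_mul, div_mul_cancel₀ _ hmτ.ne']
  have himp : g.weakPinching x * g.scalarCurvature x ^ 2 ≤
      (c * RM ^ 2 / m ^ (2 - τ) + 1) * g.scalarCurvature x ^ (2 - τ) :=
    calc g.weakPinching x * g.scalarCurvature x ^ 2 ≤ c * g.scalarCurvature x ^ 2 := hcone
      _ ≤ c * RM ^ 2 := mul_le_mul_of_nonneg_left hsq hc0.le
      _ ≤ c * RM ^ 2 + m ^ (2 - τ) := le_add_of_nonneg_right hmτ.le
      _ = (c * RM ^ 2 / m ^ (2 - τ) + 1) * m ^ (2 - τ) := hKm.symm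
      _ ≤ (c * RM ^ 2 / m ^ (2 - τ) + 1) * g.scalarCurvature x ^ (2 - τ) :=
        mul_le_mul_of_nonneg_left hrpow hK.le
  refine ⟨⟨blockA_isSymm hLC hn x e, blockC_isSymm hLC hn x e,
    trace_blockA_eq_trace_blockC hLC hn x e, ?_, ?_⟩, ?_, ?_⟩
  · rw [hscal]; exact hRpos.le
  · rw [hdev, hscal]; exact hcone
  · rw [hscal]; exact hRx
  · rw [hdev, hscal]; exact himp

end Summit.SmoothPoincare4.SmoothPoincare4.Theorems.MargerinRails

end
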